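import Summits.AtomisticToContinuum.Crystallization.Theorems.OverbindingBudgetAffineCompressedCutFirstA

/-!
# OverbindingBudget · AffineCompressedCut — rider «First» (lens-4 g79 ADDENDUM 2): part 2 of 2 (sequel of `…CompressedCutFirstA`, whose module docstring describes the rider)
Split for the 400-line cap by the landing lane (hand-2 g37); same namespace, all FQNs unchanged; `lennardJones_anti` / `floor_nonpos` ride here as `private` dedup twins (bodies verbatim).  0 sorry.
-/
namespace Summit.AtomisticToContinuum.Crystallization.Theorems.OverbindingBudgetAffineCompressedCut

open scoped BigOperators Classical
open Literature.MathematicalPhysics.StatisticalMechanics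
open Literature.Geometry.DiscreteGeometry (IsChargeFree nearestDist nearestDist_nonneg nearestDist_le_dist)
open Summit.AtomisticToContinuum.Crystallization.Theorems.OverbindingBudgetMisfitRegistration (Framed Reg DeepReg)
open Summit.AtomisticToContinuum.Crystallization.Theorems.OverbindingBudgetMisfitWindowStatements (InWindow offCount)
open Summit.AtomisticToContinuum.Crystallization.Theorems.OverbindingBudgetBalancedCensusStatements
open Summit.AtomisticToContinuum.Crystallization.Theorems.OverbindingBudgetAffineLadder
open Summit.AtomisticToContinuum.Crystallization.Theorems.OverbindingBudgetAffineLocalisation (pairSum two_mul_interactionEnergy_eq_pairSum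
  pairSum_univ_left pairSum_univ_right card_mul_floor_le_half_pairSum)
open Summit.AtomisticToContinuum.Crystallization.Theorems.OverbindingBudgetAffineMesoCut
open Summit.AtomisticToContinuum.Crystallization.Theorems.OverbindingBudgetAffinePhaseCut
open Summit.AtomisticToContinuum.Crystallization.Theorems.OverbindingBudgetAffineCushionCut
open Summit.AtomisticToContinuum.Crystallization.Theorems.OverbindingBudgetAffineTwinCut
open Summit.AtomisticToContinuum.Crystallization.Theorems.OverbindingBudgetAffineRunCut

variable {N : ℕ}
open Summit.AtomisticToContinuum.Crystallization.Theorems.OverbindingBudgetAffineCompressedCutF1 (firstShell_scale_floor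
  firstShell_scale_floor_record not_le_two_fifths_of_firstShell)
open Literature.Geometry.DiscreteGeometry (le_nearestDist fccTwoShellPattern hcpTwoShellPattern one_le_dist_of_mem_fccTwoShellPattern
  one_le_dist_of_mem_hcpTwoShellPattern norm_of_mem_fccTwoShellPattern norm_of_mem_hcpTwoShellPattern fccKissingPattern hcpKissingPattern
  fccKissingPattern_subset hcpKissingPattern_subset card_fccKissingPattern card_hcpKissingPattern norm_eq_one_of_mem_fccKissingPattern
  norm_eq_one_of_mem_hcpKissingPattern)

/-- `V` is antitone on `(0, 1]`: `0 < a ≤ b ≤ 1 → V(b) ≤ V(a)` (`V = t²/12 − t/6` in `t = r⁻⁶ ≥ 1`). [folklore; BlancLewin2015 (3)] -/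
private theorem lennardJones_anti {a b : ℝ} (ha : 0 < a) (hab : a ≤ b) (hb : b ≤ 1) : lennardJones b ≤ lennardJones a := by
  unfold lennardJones
  have hb0 : 0 < b := ha.trans_le hab
  set p := (a⁻¹) ^ 6 with hp
  set q := (b⁻¹) ^ 6 with hq
  have hq1 : 1 ≤ q := by
    have h1 : (1 : ℝ) ≤ b⁻¹ := (one_le_inv₀ hb0).2 hb
    calc (1 : ℝ) = 1 ^ 6 := by norm_num
      _ ≤ (b⁻¹) ^ 6 := pow_le_pow_left₀ zero_le_one h1 6
  have hqp : q ≤ p := pow_le_pow_left₀ (inv_nonneg.2 hb0.le) (inv_anti₀ ha hab) 6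
  have e1 : (a⁻¹) ^ 12 = p ^ 2 := by rw [hp, ← pow_mul]
  have e2 : (b⁻¹) ^ 12 = q ^ 2 := by rw [hq, ← pow_mul]
  rw [e1, e2]
  nlinarith [mul_nonneg (sub_nonneg.2 hqp) (by linarith : (0 : ℝ) ≤ p + q - 2)]

/-- `e⋆ ≤ 0`: the tree's per-subset periodisation floor at a single site (`V(0) = 0`). [tree `card_mul_floor_le_half_pairSum`] -/
private theorem floor_nonpos : (⨅ Q : PeriodicConfiguration 3, Q.energyPerParticle lennardJones) ≤ 0 := by
  let y : Fin 1 → EuclideanSpace ℝ (Fin 3) := fun _ => 0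
  have hy : Function.Injective y := Function.injective_of_subsingleton y
  have h := card_mul_floor_le_half_pairSum hy Finset.univ
  have hp : pairSum Finset.univ Finset.univ y = 0 := by
    simp [pairSum, y, lennardJones_zero]
  rw [hp, Finset.card_univ, Fintype.card_fin] at h
  simpa using h

/-- **Near-shell sum** (ratio `3`): points pairwise `≥ η` apart and all `≥ ρ ≥ 3η` from `p` have `∑ |p − z|⁻⁶ ≤ (17/6)·η⁻⁶` — the shells
`bη ≤ |p − z| < (b+1)η`, `b ≥ 3`, hold `≤ (2b+3)³ − (2b−1)³ = 48b² + 48b + 28 ≤ 68b²` points each (`card_le_of_separated_of_mem_shell`), every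
term is `≤ (bη)⁻⁶`, and `∑_{b ≥ 3} b⁻⁴ ≤ 1/24`; `68/24 = 17/6`. [this file · folklore volume packing] -/
theorem sum_inv_pow_six_le_shell_three (t : Finset (EuclideanSpace ℝ (Fin 3))) (p : EuclideanSpace ℝ (Fin 3))
    {η ρ : ℝ} (hη : 0 < η) (hρ : 3 * η ≤ ρ)
    (ht : ∀ z ∈ t, ∀ w ∈ t, z ≠ w → η ≤ dist z w) (hp : ∀ z ∈ t, ρ ≤ dist p z) :
    ∑ z ∈ t, (dist p z)⁻¹ ^ 6 ≤ 17 / 6 * η⁻¹ ^ 6 := by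
  classical
  have hρpos : 0 < ρ := by nlinarith
  have hq : (3 : ℝ) ≤ ρ / η := by rw [le_div_iff₀ hη]; linarith
  set m : EuclideanSpace ℝ (Fin 3) → ℕ := fun z => ⌊dist p z / η⌋₊ with hm
  set u := t.image m with hu_def
  set b₀ : ℕ := ⌊ρ / η⌋₊ with hb₀
  have hb₀3 : 3 ≤ b₀ := Nat.le_floor (by exact_mod_cast hq)
  have hmem : ∀ z ∈ t, m z ∈ u := fun z hz => Finset.mem_image_of_mem m hz
  have hmb : ∀ z ∈ t, b₀ ≤ m z := fun z hz =>
    Nat.floor_mono (div_le_div_of_nonneg_right (hp z hz) hη.le)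
  have hm1 : ∀ z ∈ t, 1 ≤ m z := fun z hz => le_trans (by omega) (hmb z hz)
  have hmle : ∀ z ∈ t, η * m z ≤ dist p z := fun z hz => by
    have := Nat.floor_le (div_nonneg dist_nonneg hη.le : 0 ≤ dist p z / η)
    rwa [le_div_iff₀ hη, mul_comm] at this
  have hmlt : ∀ z ∈ t, dist p z < (m z + 1) * η := fun z hz => by
    have := Nat.lt_floor_add_one (dist p z / η)
    rwa [div_lt_iff₀ hη] at this
  have hub : ∀ b ∈ u, b₀ ≤ b := fun b hb => by
    obtain ⟨z, hz, rfl⟩ := Finset.mem_image.1 hb; exact hmb z hz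
  -- (1) termwise `|p − z|⁻⁶ ≤ (η m_z)⁻⁶`
  have step1 : ∑ z ∈ t, (dist p z)⁻¹ ^ 6 ≤ ∑ z ∈ t, η⁻¹ ^ 6 * ((m z : ℝ))⁻¹ ^ 6 := by
    refine Finset.sum_le_sum fun z hz => ?_
    rw [← mul_pow, ← mul_inv]
    have h0 : 0 < η * m z := mul_pos hη (by exact_mod_cast hm1 z hz)
    exact pow_le_pow_left₀ (inv_nonneg.2 dist_nonneg) (inv_anti₀ h0 (hmle z hz)) _
  -- (2) regroup by shells of thickness `η`
  have step2 : ∑ z ∈ t, η⁻¹ ^ 6 * ((m z : ℝ))⁻¹ ^ 6 =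
      ∑ b ∈ u, ((t.filter fun z => m z = b).card : ℝ) * (η⁻¹ ^ 6 * ((b : ℝ))⁻¹ ^ 6) := by
    have := Finset.sum_fiberwise_of_maps_to' hmem (fun b : ℕ => η⁻¹ ^ 6 * ((b : ℝ))⁻¹ ^ 6)
    simp only [Finset.sum_const, nsmul_eq_mul] at this
    exact this.symm
  -- (3) each shell holds at most `48b² + 48b + 28` points
  have step3 : ∀ b ∈ u, ((t.filter fun z => m z = b).card : ℝ) ≤ 48 * (b : ℝ) ^ 2 + 48 * b + 28 := by
    intro b hb
    have hb1 : (1 : ℝ) ≤ b := by exact_mod_cast le_trans (by omega) (hb₀3.trans (hub b hb))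
    set F := t.filter fun z => m z = b with hF
    have hR₂ : (0 : ℝ) ≤ ((b : ℝ) + 1) * η := by positivity
    have hR : (b : ℝ) * η ≤ ((b : ℝ) + 1) * η := by nlinarith
    have hcard := card_le_of_separated_of_mem_shell F p hη hR₂ hR ?_ ?_
    · rw [finrank_euclideanSpace_fin] at hcard
      have e1 : 2 * (((b : ℝ) + 1) * η) / η + 1 = 2 * b + 3 := by field_simp; ring
      have e2 : 2 * ((b : ℝ) * η) / η - 1 = 2 * b - 1 := by field_simp
      have e3 : (2 * (b : ℝ) + 3) ^ 3 - (2 * b - 1) ^ 3 = 48 * (b : ℝ) ^ 2 + 48 * b + 28 := by ring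
      rw [e1, e2, max_eq_left (by linarith)] at hcard
      linarith
    · intro c hc
      obtain ⟨hct, hcb⟩ := Finset.mem_filter.1 hc
      rw [dist_comm]
      have h1 := hmle c hct
      have h2 := hmlt c hct
      rw [hcb] at h1 h2
      constructor <;> linarith
    · intro c hc c' hc' hne
      exact ht c (Finset.mem_filter.1 hc).1 c' (Finset.mem_filter.1 hc').1 hne
  -- (4) numerics per shell: `(48b² + 48b + 28) b⁻⁶ ≤ 68 b⁻⁴` for `b ≥ 3`
  have step4 : ∀ b ∈ u, (48 * (b : ℝ) ^ 2 + 48 * b + 28) * (η⁻¹ ^ 6 * ((b : ℝ))⁻¹ ^ 6) ≤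
      68 * η⁻¹ ^ 6 * ((b : ℝ))⁻¹ ^ 4 := by
    intro b hb
    have hb3 : (3 : ℝ) ≤ b := by exact_mod_cast (hb₀3.trans (hub b hb))
    have hbpos : (0 : ℝ) < b := by linarith
    set v : ℝ := ((b : ℝ))⁻¹ with hv_def
    have hv0 : 0 ≤ v := by positivity
    have hv : v ≤ 3⁻¹ := inv_anti₀ (by norm_num) hb3
    have hbv : (b : ℝ) * v = 1 := mul_inv_cancel₀ hbpos.ne'
    have e : (48 * (b : ℝ) ^ 2 + 48 * b + 28) * v ^ 6 = (48 + 48 * v + 28 * v ^ 2) * v ^ 4 := by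
      linear_combination (48 * v ^ 4 * ((b : ℝ) * v + 1) + 48 * v ^ 5) * hbv
    have hpoly : 48 + 48 * v + 28 * v ^ 2 ≤ 68 := by nlinarith [mul_le_mul hv hv hv0 (by norm_num)]
    have hη6 : 0 ≤ η⁻¹ ^ 6 := by positivity
    calc (48 * (b : ℝ) ^ 2 + 48 * b + 28) * (η⁻¹ ^ 6 * v ^ 6)
        = η⁻¹ ^ 6 * ((48 + 48 * v + 28 * v ^ 2) * v ^ 4) := by rw [← e]; ring
      _ ≤ η⁻¹ ^ 6 * (68 * v ^ 4) :=
          mul_le_mul_of_nonneg_left (mul_le_mul_of_nonneg_right hpoly (by positivity)) hη6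
      _ = 68 * η⁻¹ ^ 6 * v ^ 4 := by ring
  -- (5) the tail `∑_{b ∈ u} b⁻⁴ ≤ 1/(3 (b₀ − 1)³) ≤ 1/24`
  have step5 : ∑ b ∈ u, ((b : ℝ))⁻¹ ^ 4 ≤ 1 / (3 * ((b₀ : ℝ) - 1) ^ 3) := by
    have hsub : u ⊆ Finset.Icc b₀ (u.sup id) := fun b hb => by
      rw [Finset.mem_Icc]; exact ⟨hub b hb, Finset.le_sup (f := id) hb⟩
    calc ∑ b ∈ u, ((b : ℝ))⁻¹ ^ 4 ≤ ∑ b ∈ Finset.Icc b₀ (u.sup id), ((b : ℝ))⁻¹ ^ 4 :=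
          Finset.sum_le_sum_of_subset_of_nonneg hsub fun b _ _ => by positivity
      _ ≤ _ := sum_Icc_inv_pow_four_le (by omega) _
  have hB2 : (2 : ℝ) ≤ (b₀ : ℝ) - 1 := by
    have : (3 : ℝ) ≤ b₀ := by exact_mod_cast hb₀3
    linarith
  have hB3 : (8 : ℝ) ≤ ((b₀ : ℝ) - 1) ^ 3 := by
    have := pow_le_pow_left₀ (by norm_num : (0 : ℝ) ≤ 2) hB2 3
    linarith [show (2 : ℝ) ^ 3 = 8 by norm_num]
  have step6 : 1 / (3 * ((b₀ : ℝ) - 1) ^ 3) ≤ 1 / 24 :=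
    one_div_le_one_div_of_le (by norm_num) (by linarith)
  -- assemble
  have hη6 : 0 ≤ η⁻¹ ^ 6 := by positivity
  calc ∑ z ∈ t, (dist p z)⁻¹ ^ 6
      ≤ ∑ b ∈ u, ((t.filter fun z => m z = b).card : ℝ) * (η⁻¹ ^ 6 * ((b : ℝ))⁻¹ ^ 6) :=
        step1.trans_eq step2
    _ ≤ ∑ b ∈ u, (48 * (b : ℝ) ^ 2 + 48 * b + 28) * (η⁻¹ ^ 6 * ((b : ℝ))⁻¹ ^ 6) :=
        Finset.sum_le_sum fun b hb => mul_le_mul_of_nonneg_right (step3 b hb) (by positivity)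
    _ ≤ ∑ b ∈ u, 68 * η⁻¹ ^ 6 * ((b : ℝ))⁻¹ ^ 4 := Finset.sum_le_sum step4
    _ = 68 * η⁻¹ ^ 6 * ∑ b ∈ u, ((b : ℝ))⁻¹ ^ 4 := by rw [Finset.mul_sum]
    _ ≤ 68 * η⁻¹ ^ 6 * (1 / 24) := mul_le_mul_of_nonneg_left (step5.trans step6) (by positivity)
    _ = 17 / 6 * η⁻¹ ^ 6 := by ring

/-- **`NearFieldSlackFirstAt … δ R κ`** — the near-field law restricted to the FIRST priced class (`nn_i < s₀`: any letter, any affine class). -/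
def NearFieldSlackFirstAt (ρ ρ₁ η θ₀ s₀ s₁ ε g δ R κ : ℝ) : Prop :=
  ∃ c : ℝ, 0 < c ∧ ∀ (N : ℕ) (y : Fin N → EuclideanSpace ℝ (Fin 3)), Function.Injective y → ∀ i : Fin N,
    Priced ρ ρ₁ η θ₀ s₀ s₁ ε g δ y i → nearestDist y i < s₀ →
      (⨅ Q : PeriodicConfiguration 3, Q.energyPerParticle lennardJones) + c + κ * (nearestDist y i)⁻¹ ^ 6 ≤ nearLoad ρ ρ₁ η θ₀ s₀ s₁ ε g δ R y i

/-- **`NearFieldSlackSecondAt … δ R κ`** — the near-field law restricted to the SECOND priced class (`(ρ₁, η, θ₀)`-affinely deep and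
`nn_i < s₁`): affine-lattice sums on the `R·nn`-ball after an EXPLICIT short development of the affinely deep ball (memo §5). -/
def NearFieldSlackSecondAt (ρ ρ₁ η θ₀ s₀ s₁ ε g δ R κ : ℝ) : Prop :=
  ∃ c : ℝ, 0 < c ∧ ∀ (N : ℕ) (y : Fin N → EuclideanSpace ℝ (Fin 3)), Function.Injective y → ∀ i : Fin N,
    Priced ρ ρ₁ η θ₀ s₀ s₁ ε g δ y i → AffDeepReg ρ₁ η θ₀ g y i ∧ nearestDist y i < s₁ →
      (⨅ Q : PeriodicConfiguration 3, Q.energyPerParticle lennardJones) + c + κ * (nearestDist y i)⁻¹ ^ 6 ≤ nearLoad ρ ρ₁ η θ₀ s₀ s₁ ε g δ R y i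

/-- The near law from its two classes (`c = min c₁ c₂`). [formal bookkeeping] -/
theorem nearFieldSlackAt_of_first_second {ρ ρ₁ η θ₀ s₀ s₁ ε g δ R κ : ℝ} (h₁ : NearFieldSlackFirstAt ρ ρ₁ η θ₀ s₀ s₁ ε g δ R κ)
    (h₂ : NearFieldSlackSecondAt ρ ρ₁ η θ₀ s₀ s₁ ε g δ R κ) : NearFieldSlackAt ρ ρ₁ η θ₀ s₀ s₁ ε g δ R κ := by
  obtain ⟨c₁, hc₁, h₁⟩ := h₁
  obtain ⟨c₂, hc₂, h₂⟩ := h₂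
  refine ⟨min c₁ c₂, lt_min hc₁ hc₂, fun N y hy i hi => ?_⟩
  rcases hi.2 with h | h
  · have := h₁ N y hy i hi h
    have hm := min_le_left c₁ c₂
    linarith
  · have := h₂ N y hy i hi h
    have hm := min_le_right c₁ c₂
    linarith

/-- **THE FIRST CLASS OF THE NEAR-FIELD LAW — PROVED** at `(ρ, ε, g) = (64, 3/50, 1/450)`, `s₀ = 17/50`, `(R, κ) = (12, 1/25)`, every window,
every `(ρ₁, η, θ₀, s₁)` (the affine class is not used): `e⋆ + 1 + nn_i⁻⁶/25 ≤ nearLoad 12 (i)` at every priced site with `nn_i < 17/50`.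
Twelve first-shell repulsions at weight `≥ ½` against the near-shell sum of the `(2/5)·nn_i`-separated pullers beyond `27/20·nn_i`. [this file] -/
theorem nearFieldSlackFirstAt_record {ρ₁ η θ₀ s₁ δ : ℝ} (hδ : 0 < δ) :
    NearFieldSlackFirstAt 64 ρ₁ η θ₀ (17 / 50) s₁ (3 / 50) (1 / 450) δ 12 (1 / 25) := by
  refine ⟨1, one_pos, fun N y hy i hi hs1 => ?_⟩
  have hnn : 0 < nearestDist y i := nearestDist_pos_of_priced hδ hi
  have hF : Framed (3 / 50) (1 / 450) y i :=
    (hi.1.1 i (by rw [dist_self]; exact mul_nonneg (by norm_num) (nearestDist_nonneg y i))).2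
  set s := nearestDist y i with hs_def
  unfold nearLoad
  set S₁ := Finset.univ.filter (fun k => Priced 64 ρ₁ η θ₀ (17 / 50) s₁ (3 / 50) (1 / 450) δ y k ∧ dist (y i) (y k) ≤ 12 * s) with hS₁
  set S₂ := Finset.univ.filter (fun k => (Sound 64 (3 / 50) (1 / 450) δ y k ∧ ¬ Priced 64 ρ₁ η θ₀ (17 / 50) s₁ (3 / 50) (1 / 450) δ y k) ∧
    dist (y i) (y k) ≤ 12 * s) with hS₂
  set S₃ := Finset.univ.filter (fun k => ¬ Sound 64 (3 / 50) (1 / 450) δ y k ∧ dist (y i) (y k) ≤ 12 * s) with hS₃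
  set Near := Finset.univ.filter (fun k => dist (y i) (y k) ≤ 12 * s) with hNear
  set A := Near.filter (fun k => k ≠ i ∧ dist (y i) (y k) ≤ 53 / 50 * s) with hA
  set T := (Near.filter fun k => ¬ (k ≠ i ∧ dist (y i) (y k) ≤ 53 / 50 * s)).filter
    (fun k => k ≠ i ∧ 2 / 5 * s < nearestDist y k) with hT
  set V₀ := lennardJones (53 / 50 * s) with hV₀
  set f : Fin N → ℝ := fun k => if k ≠ i ∧ dist (y i) (y k) ≤ 53 / 50 * s then 1 / 2 * V₀
      else -(if k ≠ i ∧ 2 / 5 * s < nearestDist y k then 1 / 6 * (dist (y i) (y k))⁻¹ ^ 6 else 0) with hf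
  -- (0) the first-shell potential floor `V ≥ V₀ ≥ 0` and the weight floor `w ≥ ½`
  have hs36 : 53 / 50 * s ≤ 1 := by linarith
  have hV₀pos : 0 ≤ V₀ := by
    refine lennardJones_nonneg_of_pow_le (by positivity) ?_
    have h1 : 53 / 50 * s ≤ 1 / 2 := by linarith
    exact (pow_le_pow_left₀ (by positivity) h1 6).trans (by norm_num)
  have hVd : ∀ k, k ≠ i → dist (y i) (y k) ≤ 53 / 50 * s → V₀ ≤ lennardJones (dist (y i) (y k)) := fun k hki hd =>
    lennardJones_anti (dist_pos.2 (hy.ne hki.symm)) hd hs36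
  have hw : ∀ k, k ≠ i → dist (y i) (y k) ≤ 53 / 50 * s → 1 / 2 ≤ scaleWeight y i k := by
    intro k hki hd
    have h := not_le_two_fifths_of_firstShell hy hF hki (by rwa [dist_comm]) hnn
    unfold scaleWeight
    rw [if_neg h]
    split_ifs <;> norm_num
  have hdpos : ∀ k, ¬ dist (y i) (y k) ≤ 53 / 50 * s → 0 < dist (y i) (y k) := fun k hd =>
    lt_of_lt_of_le (by positivity) (not_le.1 hd).le
  -- (1) termwise: the comparison function `f` is below each of the three near summands
  have h1 : ∀ k ∈ S₁, f k ≤ scaleWeight y i k * lennardJones (dist (y i) (y k)) := by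
    intro k hk
    simp only [hf]
    by_cases hc1 : k ≠ i ∧ dist (y i) (y k) ≤ 53 / 50 * s
    · rw [if_pos hc1]
      have hV := hVd k hc1.1 hc1.2
      have hw' := hw k hc1.1 hc1.2
      nlinarith [mul_nonneg (sub_nonneg.2 hw') (hV₀pos.trans hV)]
    · rw [if_neg hc1]
      by_cases hki : k = i
      · subst hki
        simp [lennardJones_zero]
      · have hd : ¬ dist (y i) (y k) ≤ 53 / 50 * s := fun h => hc1 ⟨hki, h⟩
        by_cases hc2 : 2 / 5 * s < nearestDist y k
        · rw [if_pos ⟨hki, hc2⟩]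
          exact neg_le_mul_lennardJones (scaleWeight_nonneg y i k) (scaleWeight_le_one y i k) (hdpos k hd)
        · rw [if_neg (fun h => hc2 h.2), neg_zero]
          have hw0 : scaleWeight y i k = 0 := by
            unfold scaleWeight
            rw [if_pos (not_lt.1 hc2)]
          rw [hw0, zero_mul]
  have h2 : ∀ k ∈ S₂, f k ≤ lennardJones (dist (y i) (y k)) := by
    intro k hk
    have hk' := (Finset.mem_filter.1 hk).2
    have hki : k ≠ i := by
      rintro rfl
      exact hk'.1.2 hi
    have hnk : 2 / 5 * s < nearestDist y k := by
      have h17 : 17 / 50 ≤ nearestDist y k := not_lt.1 fun h => hk'.1.2 ⟨hk'.1.1, Or.inl h⟩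
      linarith
    simp only [hf]
    by_cases hd : dist (y i) (y k) ≤ 53 / 50 * s
    · rw [if_pos ⟨hki, hd⟩]
      have hV := hVd k hki hd
      linarith
    · rw [if_neg (fun h => hd h.2), if_pos ⟨hki, hnk⟩]
      exact neg_le_lennardJones_of_le (hdpos k hd) le_rfl
  have h3 : ∀ k ∈ S₃, f k ≤ max (lennardJones (dist (y i) (y k))) 0 := by
    intro k _
    simp only [hf]
    by_cases hc1 : k ≠ i ∧ dist (y i) (y k) ≤ 53 / 50 * s
    · rw [if_pos hc1]
      have hV := hVd k hc1.1 hc1.2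
      exact le_trans (by linarith) (hV.trans (le_max_left _ _))
    · rw [if_neg hc1]
      refine le_trans ?_ (le_max_right _ _)
      rw [neg_nonpos]
      split_ifs
      · positivity
      · exact le_rfl
  -- (2) the three near classes partition the near ball
  have hpart : ∑ k ∈ Near, f k = ∑ k ∈ S₁, f k + ∑ k ∈ S₂, f k + ∑ k ∈ S₃, f k := by
    rw [← Finset.sum_filter_add_sum_filter_not Near (fun k => Priced 64 ρ₁ η θ₀ (17 / 50) s₁ (3 / 50) (1 / 450) δ y k),
      ← Finset.sum_filter_add_sum_filter_not (Near.filter fun k => ¬ Priced 64 ρ₁ η θ₀ (17 / 50) s₁ (3 / 50) (1 / 450) δ y k)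
        (fun k => Sound 64 (3 / 50) (1 / 450) δ y k)]
    have e1 : Near.filter (fun k => Priced 64 ρ₁ η θ₀ (17 / 50) s₁ (3 / 50) (1 / 450) δ y k) = S₁ := by
      ext k
      simp only [hNear, hS₁, Finset.mem_filter, Finset.mem_univ, true_and]
      tauto
    have e2 : (Near.filter fun k => ¬ Priced 64 ρ₁ η θ₀ (17 / 50) s₁ (3 / 50) (1 / 450) δ y k).filter
        (fun k => Sound 64 (3 / 50) (1 / 450) δ y k) = S₂ := by
      ext k
      simp only [hNear, hS₂, Finset.mem_filter, Finset.mem_univ, true_and]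
      tauto
    have e3 : (Near.filter fun k => ¬ Priced 64 ρ₁ η θ₀ (17 / 50) s₁ (3 / 50) (1 / 450) δ y k).filter
        (fun k => ¬ Sound 64 (3 / 50) (1 / 450) δ y k) = S₃ := by
      ext k
      simp only [hNear, hS₃, Finset.mem_filter, Finset.mem_univ, true_and]
      constructor
      · rintro ⟨⟨hn, -⟩, hS⟩
        exact ⟨hS, hn⟩
      · rintro ⟨hS, hn⟩
        exact ⟨⟨hn, fun hP => hS hP.1⟩, hS⟩
    rw [e1, e2, e3]
    ring
  -- (3) the near sum of `f`: `½V₀` per first-shell partner, `−d⁻⁶/6` per puller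
  have hNf : ∑ k ∈ Near, f k = 1 / 2 * V₀ * A.card - 1 / 6 * ∑ k ∈ T, (dist (y i) (y k))⁻¹ ^ 6 := by
    rw [← Finset.sum_filter_add_sum_filter_not Near (fun k => k ≠ i ∧ dist (y i) (y k) ≤ 53 / 50 * s)]
    have eA : ∑ k ∈ A, f k = ∑ k ∈ A, 1 / 2 * V₀ := Finset.sum_congr rfl fun k hk => by
      simp only [hf]
      rw [if_pos (Finset.mem_filter.1 hk).2]
    have eB : ∑ k ∈ Near.filter (fun k => ¬ (k ≠ i ∧ dist (y i) (y k) ≤ 53 / 50 * s)), f k =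
        ∑ k ∈ Near.filter (fun k => ¬ (k ≠ i ∧ dist (y i) (y k) ≤ 53 / 50 * s)),
          -(if k ≠ i ∧ 2 / 5 * s < nearestDist y k then 1 / 6 * (dist (y i) (y k))⁻¹ ^ 6 else 0) :=
      Finset.sum_congr rfl fun k hk => by
        simp only [hf]
        rw [if_neg (Finset.mem_filter.1 hk).2]
    have eC : ∑ k ∈ Near.filter (fun k => ¬ (k ≠ i ∧ dist (y i) (y k) ≤ 53 / 50 * s)),
        (if k ≠ i ∧ 2 / 5 * s < nearestDist y k then 1 / 6 * (dist (y i) (y k))⁻¹ ^ 6 else 0) =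
          1 / 6 * ∑ k ∈ T, (dist (y i) (y k))⁻¹ ^ 6 := by
      rw [Finset.mul_sum]
      exact (Finset.sum_filter _ _).symm
    rw [eA, eB, Finset.sum_neg_distrib, eC, Finset.sum_const, nsmul_eq_mul]
    ring
  -- (4) at least twelve first-shell partners
  have hAcard : 12 ≤ A.card := by
    refine (twelve_le_card_firstShell (by norm_num) hF hnn).trans (Finset.card_le_card fun k hk => ?_)
    have hk' := (Finset.mem_filter.1 hk).2
    have hd : dist (y i) (y k) ≤ 53 / 50 * s := by
      have := hk'.2; rwa [show (1 : ℝ) + 3 / 50 = 53 / 50 by norm_num] at this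
    refine Finset.mem_filter.2 ⟨Finset.mem_filter.2 ⟨Finset.mem_univ _, ?_⟩, hk'.1, hd⟩
    linarith
  -- (5) the pullers: `(2/5)s`-separated, beyond `27/20·s` — near-shell sum
  have hTsum : ∑ k ∈ T, (dist (y i) (y k))⁻¹ ^ 6 ≤ 17 / 6 * (2 / 5 * s)⁻¹ ^ 6 := by
    have himg : ∑ z ∈ T.image y, (dist (y i) z)⁻¹ ^ 6 = ∑ k ∈ T, (dist (y i) (y k))⁻¹ ^ 6 :=
      Finset.sum_image fun k _ l _ h => hy h
    rw [← himg]
    refine sum_inv_pow_six_le_shell_three (T.image y) (y i) (η := 2 / 5 * s) (ρ := 27 / 20 * s) (by positivity) (by linarith) ?_ ?_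
    · intro z hz w hw hzw
      obtain ⟨k, hk, rfl⟩ := Finset.mem_image.1 hz
      obtain ⟨l, hl, rfl⟩ := Finset.mem_image.1 hw
      have hkl : k ≠ l := fun h => hzw (by rw [h])
      exact ((Finset.mem_filter.1 hk).2.2).le.trans (nearestDist_le_dist y hkl.symm)
    · intro z hz
      obtain ⟨k, hk, rfl⟩ := Finset.mem_image.1 hz
      have hk1 := Finset.mem_filter.1 hk
      have hk2 := (Finset.mem_filter.1 hk1.1).2
      have hki : k ≠ i := hk1.2.1
      exact le_dist_of_not_firstShell_record hF hki (fun h => hk2 ⟨hki, h⟩)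
  -- (6) numerics: `u = s⁻⁶ ≥ (50/17)⁶ ≥ 647`, `6·V₀ − (17/36)(5/2)⁶·u ≥ 1 + u/25`
  have hu : (647 : ℝ) ≤ s⁻¹ ^ 6 := by
    have h1 : (50 / 17 : ℝ) ≤ s⁻¹ := by
      rw [le_inv_comm₀ (by norm_num) hnn]
      exact le_trans hs1.le (by norm_num)
    exact le_trans (by norm_num) (pow_le_pow_left₀ (by norm_num) h1 6)
  have e6 : (53 / 50 * s)⁻¹ ^ 6 = (50 / 53) ^ 6 * s⁻¹ ^ 6 := by rw [mul_inv, mul_pow]; norm_num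
  have e12 : (53 / 50 * s)⁻¹ ^ 12 = (50 / 53) ^ 12 * (s⁻¹ ^ 6) ^ 2 := by rw [mul_inv, mul_pow, ← pow_mul]; norm_num
  have e25 : (2 / 5 * s)⁻¹ ^ 6 = (5 / 2) ^ 6 * s⁻¹ ^ 6 := by rw [mul_inv, mul_pow]; norm_num
  have hV₀' : V₀ = 1 / 12 * (53 / 50 * s)⁻¹ ^ 12 - 1 / 6 * (53 / 50 * s)⁻¹ ^ 6 := rfl
  have key : 1 + 1 / 25 * s⁻¹ ^ 6 ≤ 6 * V₀ - 1 / 6 * (17 / 6 * (2 / 5 * s)⁻¹ ^ 6) := by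
    rw [hV₀', e6, e12, e25]
    nlinarith [hu, mul_le_mul_of_nonneg_right hu (by positivity : (0 : ℝ) ≤ s⁻¹ ^ 6)]
  -- (7) assemble
  have hAV : 6 * V₀ ≤ 1 / 2 * V₀ * A.card := by
    have h12 : (12 : ℝ) ≤ A.card := by exact_mod_cast hAcard
    nlinarith [hV₀pos]
  have hfloor := floor_nonpos
  linarith [Finset.sum_le_sum h1, Finset.sum_le_sum h2, Finset.sum_le_sum h3, hpart, hNf, hTsum, key, hAV, hfloor]

/-- **`NearFieldSlackMinSecond R κ`** («NS♭₂») — the SECOND (affine) class of the economical near-field law, all windows: at every sound,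
`(12, 10⁻⁴, 10⁻³)`-affinely deep site with `nn_i < 17/20`, `e⋆ + c + κ·nn_i⁻⁶ ≤ nearLoad R (i)`.  THE OPEN LEAF of the node after §6c (the first
class is proved: `nearFieldSlackFirstAt_record`).  Plan (memo §5 (a)): an EXPLICIT short affine development of the `(12, 10⁻⁴, 10⁻³)`-deep ball (every
site of the `12·nn`-ball within `D·(ε₁ + θ₀)·k·nn` of an affine image `y i + a₀·B(Λ)` of fcc/hcp, explicit `D`; NOT the record's `hA :
AffineChartStraightening`, whose constant is existential), then the affine-lattice near sum at weights `½ ≤ w ≤ 1` on the first shell and `≤ 1`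
beyond, against `e⋆ ≤ ½·ζ_Λ`-type floors already in the tree's cone; margin `≈ 0.3` at `nn = 17/20` (memo §4). [this file · kind: statement · WEAKER than
`NearFieldSlackMin 12 (1/25)` (its second class verbatim) · TRUE-type · ATTACKABLE-M] -/
def NearFieldSlackMinSecond (R κ : ℝ) : Prop :=
  ∀ δ : ℝ, 0 < δ → δ ≤ 2 → NearFieldSlackSecondAt 64 12 (1 / 10 ^ 4) (1 / 1000) (17 / 50) (17 / 20) (3 / 50) (1 / 450) δ R κ

/-- The second-class law is the near law restricted: `NearFieldSlackAt → NearFieldSlackSecondAt` (NS♭₂ is WEAKER than NS♭). [formal bookkeeping] -/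
theorem nearFieldSlackSecondAt_of_nearFieldSlackAt {ρ ρ₁ η θ₀ s₀ s₁ ε g δ R κ : ℝ} (h : NearFieldSlackAt ρ ρ₁ η θ₀ s₀ s₁ ε g δ R κ) :
    NearFieldSlackSecondAt ρ ρ₁ η θ₀ s₀ s₁ ε g δ R κ := by
  obtain ⟨c, hc, h⟩ := h
  exact ⟨c, hc, fun N y hy i hi _ => h N y hy i hi⟩

/-- `NS♭(12, 1/25) → NS♭₂(12, 1/25)`. [formal bookkeeping] -/
theorem nearFieldSlackMinSecond_of_min {R κ : ℝ} (h : NearFieldSlackMin R κ) : NearFieldSlackMinSecond R κ :=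
  fun δ hδ hδ2 => nearFieldSlackSecondAt_of_nearFieldSlackAt (h δ hδ hδ2)

/-- `NS♭₂(12, 1/25) → NS♭(12, 1/25)` (the first class is proved): at `(12, 1/25)` the two are EQUIVALENT. [this file] -/
theorem nearFieldSlackMin_of_second (h : NearFieldSlackMinSecond 12 (1 / 25)) : NearFieldSlackMin 12 (1 / 25) :=
  fun δ hδ hδ2 => nearFieldSlackAt_of_first_second (nearFieldSlackFirstAt_record hδ) (h δ hδ hδ2)

/-- **`NearFieldSlackMinSecond 12 (1/25) → CompressedRun`** — RO from the affine-class near law ALONE (first class, far field, `PS → KD → RO`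
all proved here). [this file] -/
theorem compressedRun_of_nearFieldSlackMinSecond (h : NearFieldSlackMinSecond 12 (1 / 25)) : CompressedRun :=
  compressedRun_of_nearFieldSlackMin (nearFieldSlackMin_of_second h)

end Summit.AtomisticToContinuum.Crystallization.Theorems.OverbindingBudgetAffineCompressedCut
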